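import Summits.QuantumFields.BalabanUV.T4Continuum.Support.RegularBackgroundTower

/-!
# T⁴ programme, SUBSTRATE — `Support/RegularBackgroundLocal`: the INDEX-WEIGHTED (LOCAL, multi-index) twin of the
# regularity class `RegularBackgroundTower.RegularTransporters` on the NE2 carriers — [Balaban1985BackgroundPropagators]
# (3.35) with the index `j ≤ k` of the cube as a parameter — reducing to the global class at constant index `j = k`
# (v1.1, append-only §4: degraded-constant `zTower`∕`dconnTower` bounds via `toGlobal`)

Audit cell `pub-balaban`, SUBSTRATE cell seat p4 (focus «background-field regularity; reuse `RegularBackgroundTower*`»); companion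
of `Support/SmallFieldDomains*` (the `ℤ^d` region geometry that PRODUCES an index map: point index `ptIndex`, class cubes,
coverings) — here the index map is an abstract PARAMETER `ι : (k : ℕ) → T_{L^{−k}} → ℕ` with `ι k x ≤ k`, so the file is
independent of how the index is obtained (torus reading of a domain sequence, periodic lift, or the global `ι ≡ k`).

WHAT IS PRINTED (documentation; nothing asserted).  [Balaban1985BackgroundPropagators] p. 396 (3.35): *"for an arbitrary
cube □ of the described above class … there exists a gauge transformation u on □ such that Uᵘ = e^{iηA}, and if the index
of □ is j, then |A| < O(1)Mα₀(L^jη)^{−1}, |∇^η A| < O(1)Mα₀(L^jη)^{−2} on □"*.  `RegularBackgroundTower.RegularTransporters`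
(row B5 of `t4/SKELETON-NE2-P1.md`, p207786) types the GLOBAL case `j = k` (`L^jη = 1`): SIZE `‖L^k·(R^{(k)}_ν(x) − 1)‖ ≤ α`,
LATTICE-LIPSCHITZ `‖L^k·(R^{(k)}_ν(x+e_μ) − R^{(k)}_ν(x))‖ ≤ β/L^k`, and declares the LOCAL case a non-applicability
(`t4/SKELETON-NE2-P1.md` l.100 (i)).  With `η = L^{−k}` the printed local bounds read (`U = e^{iηA}`, `R − 1 ≈ iηA`):
`‖L^k(R − 1)‖ ≲ |A| ≤ α·(L^jη)^{−1} = α·L^{k−j}` and `‖L^k(R(x+e_μ) − R(x))‖ ≈ η|∇^ηA| ≤ β·(L^jη)^{−2}·η = β·(L^{k−j})²/L^k`.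

WHAT THIS FILE PROVIDES (all `[folklore]`):
 * §1 **`RegularTransportersLocal L M R ι α β`** — hypothesis STRUCTURE on transporter data (like `RegularTransporters`; nothing
   asserted): `ι k x ≤ k`, SIZE `≤ α·L^{k − ι k x}`, LATTICE-LIPSCHITZ `≤ β·(L^{k − ι k x})²/L^k` at the site `x = i.1` of the index
   `i : idx L M k`;
 * §2 THE DICTIONARY WITH THE GLOBAL CLASS: `RegularTransporters R α β ↔ RegularTransportersLocal R (fun k _ => k) α β`
   (`regularTransportersLocal_const_iff`); global ⇒ local for ANY index map (`RegularTransporters.toLocal`, weights `≥ 1`);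
   monotonicity in the index map (`RegularTransportersLocal.anti_index`: lowering indices weakens) and in `(α, β)`; and the
   DEGRADED-CONSTANT CONVERSE **`RegularTransportersLocal.toGlobal`**: if every index is within `m` of the top (`k ≤ ι k x + m`),
   the global class holds with `(α·L^m, β·L^{2m})` — the form in which row NE2's global tier-B machinery applies to a
   configuration regular only down to `m` levels below the top;
 * §3 the weighted consequences for the coefficient towers of `RegularBackgroundTower` (`connTower = L^k(R − 1)`):
   `‖w(x)‖ ≤ α·L^{k−ι}`, `‖w(x+e_μ) − w(x)‖ ≤ β·(L^{k−ι})²/L^k`.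
HONEST FRAMING (T4-DAG p. 1).  Bookkeeping over finite matrices, MODEL LEVEL (transporters are data); no configuration of Bałaban's is
asserted regular; the existence of a regular gauge for the minimisers ([B8], [B11] Thm 1) is NOT used or asserted — it is where a
consumer would get the hypothesis from.  NOT NE2 content (no perturbation law is derived here: the local two-level analysis with
Dirichlet holes is row NE2's declared non-applicability and stays so); spine 0/9 unchanged; NOT infinite volume, NOT a mass gap, NOT
Clay.  HONEST DEPENDENCY: continuum YM on T⁴ ⇐ BetaPertH ∧ nine spine estimates (0/9 proved); BetaPertH ⇐ (D1) ∧ (D4) ∧ CAP+tail;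
G-an2-4 gates asym, D1 and NE2/3/4.  No `sorry`.
-/

noncomputable section

open scoped BigOperators ComplexConjugate Matrix Matrix.Norms.L2Operator

namespace Summit.QuantumFields.BalabanUV.T4Continuum.RegularBackgroundLocal

open Literature.MathematicalPhysics.QuantumFieldTheory.Balaban1983to89.B5Prop11Plancherel
open Literature.MathematicalPhysics.QuantumFieldTheory.Balaban1983to89.B5G183RateUnitTower (lev lev_neZero)
open Summit.QuantumFields.BalabanUV.T4Continuum
open Summit.QuantumFields.BalabanUV.T4Continuum.BalabanAveragedTowerUnit (idx one_le_lev' cast_lev')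
open Summit.QuantumFields.BalabanUV.T4Continuum.BlockPairingGeometry (tau)
open Summit.QuantumFields.BalabanUV.T4Continuum.RegularBackgroundTower

variable {d : ℕ} {o : Type*} [DecidableEq o] [Fintype o]

/-! ## §1 The local (index-weighted) regularity class on transporter data -/

section Structure
variable (L : ℕ) (M : Fin d → ℕ)

/-- **THE PRINTED REGULARITY CLASS (3.35) WITH THE CUBE INDEX AS A PARAMETER, ON TRANSPORTER DATA**: at RG level `k`
(lattice `T_{L^{−k}}`), every site `x` carries an index `ι k x ≤ k` (the index of the class cube through `x`); SIZE
`‖L^k·(R^{(k)}_ν(x) − 1)‖ ≤ α·L^{k − ι k x}` and LATTICE-LIPSCHITZ `‖L^k·(R^{(k)}_ν(x + e_μ) − R^{(k)}_ν(x))‖ ≤ β·(L^{k − ι k x})²/L^k`.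
A hypothesis structure on data; nothing is asserted about Bałaban's minimisers (typed READING of [Balaban1985BackgroundPropagators]
(3.35) p. 396 in lattice units). [folklore] -/
structure RegularTransportersLocal (R : (k : ℕ) → Fin d → (idx L M k → Matrix o o ℂ))
    (ι : (k : ℕ) → Tor (fine (lev L k) M) → ℕ) (α β : ℝ) : Prop where
  /-- `α, β ≥ 0` -/
  nonneg : 0 ≤ α ∧ 0 ≤ β
  /-- the index never exceeds the level -/
  index_le : ∀ k x, ι k x ≤ k
  /-- size of the connection in lattice units, weighted by the index -/
  size : ∀ k ν (i : idx L M k), ‖((lev L k : ℕ) : ℂ) • (R k ν i - 1)‖ ≤ α * (L : ℝ) ^ (k - ι k i.1)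
  /-- lattice-Lipschitz bound of the transporters, weighted by the index -/
  lipschitz : ∀ k ν μ (i : idx L M k),
    ‖((lev L k : ℕ) : ℂ) • (R k ν (tau (fine (lev L k) M) μ i) - R k ν i)‖ ≤
      β * ((L : ℝ) ^ (k - ι k i.1)) ^ 2 / (lev L k : ℕ)

end Structure

/-! ## §2 The dictionary with the global class -/

section Dictionary
variable {L : ℕ} [NeZero L] {M : Fin d → ℕ} {R : (k : ℕ) → Fin d → (idx L M k → Matrix o o ℂ)}
  {ι ι' : (k : ℕ) → Tor (fine (lev L k) M) → ℕ} {α β α' β' : ℝ}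

omit [NeZero L] in
/-- **CONSTANT INDEX = THE GLOBAL CLASS**: at `ι ≡ k` the weights are `L^0 = 1`. [folklore] -/
theorem regularTransportersLocal_const_iff :
    RegularTransportersLocal L M R (fun k _ => k) α β ↔ RegularTransporters L M R α β := by
  constructor
  · intro h
    refine ⟨h.nonneg, fun k ν i => ?_, fun k ν μ i => ?_⟩
    · simpa using h.size k ν i
    · simpa using h.lipschitz k ν μ i
  · intro h
    refine ⟨h.nonneg, fun k _ => le_rfl, fun k ν i => ?_, fun k ν μ i => ?_⟩
    · simpa using h.size k ν i
    · simpa using h.lipschitz k ν μ i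

/-- **GLOBAL ⇒ LOCAL for any admissible index map** (`L ≥ 1`: the weights `L^{k−ι} ≥ 1` only weaken the bounds). [folklore] -/
theorem _root_.Summit.QuantumFields.BalabanUV.T4Continuum.RegularBackgroundTower.RegularTransporters.toLocal
    (h : RegularTransporters L M R α β) (hL : 1 ≤ L) (hι : ∀ k x, ι k x ≤ k) : RegularTransportersLocal L M R ι α β := by
  have hL' : (1 : ℝ) ≤ L := by exact_mod_cast hL
  have hw : ∀ n : ℕ, (1 : ℝ) ≤ (L : ℝ) ^ n := fun n => one_le_pow₀ hL'
  refine ⟨h.nonneg, hι, fun k ν i => ?_, fun k ν μ i => ?_⟩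
  · exact (h.size k ν i).trans (le_mul_of_one_le_right h.nonneg.1 (hw _))
  · refine (h.lipschitz k ν μ i).trans ?_
    have hlev : (0 : ℝ) < (lev L k : ℕ) := by exact_mod_cast one_le_lev' L k
    refine div_le_div_of_nonneg_right ?_ hlev.le
    exact le_mul_of_one_le_right h.nonneg.2 (by nlinarith [hw (k - ι k i.1)])

/-- MONOTONICITY IN THE INDEX MAP: LOWERING indices (pointwise `ι' ≤ ι`) weakens the class (`L ≥ 1`). [folklore] -/
theorem RegularTransportersLocal.anti_index (h : RegularTransportersLocal L M R ι α β) (hL : 1 ≤ L)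
    (hι' : ∀ k x, ι' k x ≤ ι k x) : RegularTransportersLocal L M R ι' α β := by
  have hL' : (1 : ℝ) ≤ L := by exact_mod_cast hL
  have hw : ∀ k x, (L : ℝ) ^ (k - ι k x) ≤ (L : ℝ) ^ (k - ι' k x) := fun k x =>
    pow_le_pow_right₀ hL' (by have := hι' k x; omega)
  refine ⟨h.nonneg, fun k x => (hι' k x).trans (h.index_le k x), fun k ν i => ?_, fun k ν μ i => ?_⟩
  · exact (h.size k ν i).trans (mul_le_mul_of_nonneg_left (hw k i.1) h.nonneg.1)
  · refine (h.lipschitz k ν μ i).trans ?_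
    have hlev : (0 : ℝ) < (lev L k : ℕ) := by exact_mod_cast one_le_lev' L k
    refine div_le_div_of_nonneg_right ?_ hlev.le
    refine mul_le_mul_of_nonneg_left ?_ h.nonneg.2
    exact pow_le_pow_left₀ (pow_nonneg (by positivity) _) (hw k i.1) 2

/-- Monotonicity in the constants. [folklore] -/
theorem RegularTransportersLocal.mono (h : RegularTransportersLocal L M R ι α β) (hα : α ≤ α') (hβ : β ≤ β') :
    RegularTransportersLocal L M R ι α' β' := by
  refine ⟨⟨h.nonneg.1.trans hα, h.nonneg.2.trans hβ⟩, h.index_le, fun k ν i => ?_, fun k ν μ i => ?_⟩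
  · exact (h.size k ν i).trans (mul_le_mul_of_nonneg_right hα (pow_nonneg (Nat.cast_nonneg _) _))
  · refine (h.lipschitz k ν μ i).trans ?_
    have hlev : (0 : ℝ) < (lev L k : ℕ) := by exact_mod_cast one_le_lev' L k
    exact div_le_div_of_nonneg_right (mul_le_mul_of_nonneg_right hβ (sq_nonneg _)) hlev.le

/-- **THE DEGRADED-CONSTANT CONVERSE**: if every index is within `m` of the top (`k ≤ ι k x + m` — the configuration is
regular at scale `≥ k − m` everywhere), the GLOBAL class holds with constants `(α·L^m, β·L^{2m})` (`L ≥ 1`). [folklore] -/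
theorem RegularTransportersLocal.toGlobal (h : RegularTransportersLocal L M R ι α β) (hL : 1 ≤ L) {m : ℕ}
    (hm : ∀ k x, k ≤ ι k x + m) : RegularTransporters L M R (α * (L : ℝ) ^ m) (β * (L : ℝ) ^ (2 * m)) := by
  have hL' : (1 : ℝ) ≤ L := by exact_mod_cast hL
  have hw : ∀ k x, (L : ℝ) ^ (k - ι k x) ≤ (L : ℝ) ^ m := fun k x =>
    pow_le_pow_right₀ hL' (by have := hm k x; omega)
  refine ⟨⟨mul_nonneg h.nonneg.1 (by positivity), mul_nonneg h.nonneg.2 (by positivity)⟩, fun k ν i => ?_,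
    fun k ν μ i => ?_⟩
  · exact (h.size k ν i).trans (mul_le_mul_of_nonneg_left (hw k i.1) h.nonneg.1)
  · refine (h.lipschitz k ν μ i).trans ?_
    have hlev : (0 : ℝ) < (lev L k : ℕ) := by exact_mod_cast one_le_lev' L k
    refine div_le_div_of_nonneg_right ?_ hlev.le
    refine mul_le_mul_of_nonneg_left ?_ h.nonneg.2
    calc ((L : ℝ) ^ (k - ι k i.1)) ^ 2 ≤ ((L : ℝ) ^ m) ^ 2 :=
          pow_le_pow_left₀ (pow_nonneg (by positivity) _) (hw k i.1) 2
      _ = (L : ℝ) ^ (2 * m) := by rw [← pow_mul, mul_comm]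

/-- In particular a configuration regular at EVERY scale down to the top minus `0` (all indices `= k`) is globally regular with
the same constants. [folklore] -/
theorem RegularTransportersLocal.toGlobal_of_top (h : RegularTransportersLocal L M R ι α β) (hL : 1 ≤ L)
    (htop : ∀ k x, ι k x = k) : RegularTransporters L M R α β := by
  have := h.toGlobal hL (m := 0) (fun k x => by rw [htop k x]; omega)
  simpa using this

end Dictionary

/-! ## §3 Weighted consequences for the coefficient towers -/

section Towers
variable {L : ℕ} {M : Fin d → ℕ} {R : (k : ℕ) → Fin d → (idx L M k → Matrix o o ℂ)}
  {ι : (k : ℕ) → Tor (fine (lev L k) M) → ℕ} {α β : ℝ}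

/-- SIZE of the connection tower `w = L^k(R − 1)`: `‖w^{(k)}_ν(x)‖ ≤ α·L^{k − ι k x}`. [folklore] -/
theorem norm_connTower_le_local (h : RegularTransportersLocal L M R ι α β) (k : ℕ) (ν : Fin d) (i : idx L M k) :
    ‖connTower L M R k ν i‖ ≤ α * (L : ℝ) ^ (k - ι k i.1) := h.size k ν i

/-- LIPSCHITZ of the connection tower: `‖w(x + e_μ) − w(x)‖ ≤ β·(L^{k − ι k x})²/L^k`. [folklore] -/
theorem connTower_lipschitz_local (h : RegularTransportersLocal L M R ι α β) (k : ℕ) (ν μ : Fin d) (i : idx L M k) :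
    ‖connTower L M R k ν (tau (fine (lev L k) M) μ i) - connTower L M R k ν i‖ ≤
      β * ((L : ℝ) ^ (k - ι k i.1)) ^ 2 / (lev L k : ℕ) := by
  rw [connTower_tau_sub]; exact h.lipschitz k ν μ i

/-- At a site of top index (`ι k x = k`) the global bounds hold verbatim. [folklore] -/
theorem norm_connTower_le_of_top (h : RegularTransportersLocal L M R ι α β) {k : ℕ} (ν : Fin d) {i : idx L M k}
    (htop : ι k i.1 = k) : ‖connTower L M R k ν i‖ ≤ α := by
  rw [connTower_eq]; simpa [htop] using h.size k ν i

end Towers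


/-! ## §4 (v1.1, append-only) Degraded-constant consequences for the zeroth-order tower -/

section ZTower
variable {L : ℕ} [NeZero L] {M : Fin d → ℕ} {R : (k : ℕ) → Fin d → (idx L M k → Matrix o o ℂ)}
  {ι : (k : ℕ) → Tor (fine (lev L k) M) → ℕ} {α β : ℝ}

/-- **ZEROTH-ORDER SIZE UNDER LOCAL REGULARITY WITH INDICES WITHIN `m` OF THE TOP**: `‖z‖ ≤ d·((αL^m)² + 2βL^{2m})` — the global
`RegularBackgroundTower.norm_zTower_le` through `toGlobal` (so row NE2's `boundedBackgroundM_of_regular`-type consumers run on such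
configurations with the degraded constants). [folklore] -/
theorem norm_zTower_le_of_local (h : RegularTransportersLocal L M R ι α β) (hL : 1 ≤ L) {m : ℕ} (hm : ∀ k x, k ≤ ι k x + m)
    (k : ℕ) (i : idx L M k) :
    ‖zTower L M R k i‖ ≤ d * ((α * (L : ℝ) ^ m) ^ 2 + 2 * (β * (L : ℝ) ^ (2 * m))) :=
  norm_zTower_le (h.toGlobal hL hm) k i

/-- The lattice-derivative tower under the same hypothesis: `‖L^k(w − w∘τ⁻¹)‖ ≤ β·L^{2m}`. [folklore] -/
theorem norm_dconnTower_le_of_local (h : RegularTransportersLocal L M R ι α β) (hL : 1 ≤ L) {m : ℕ} (hm : ∀ k x, k ≤ ι k x + m)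
    (k : ℕ) (ν : Fin d) (i : idx L M k) : ‖dconnTower L M R k ν i‖ ≤ β * (L : ℝ) ^ (2 * m) :=
  norm_dconnTower_le (h.toGlobal hL hm) k ν i

/-- At the TOP everywhere (`ι ≡ k`) the global zeroth-order bound `‖z‖ ≤ d(α² + 2β)` holds verbatim. [folklore] -/
theorem norm_zTower_le_of_top (h : RegularTransportersLocal L M R ι α β) (hL : 1 ≤ L) (htop : ∀ k x, ι k x = k) (k : ℕ)
    (i : idx L M k) : ‖zTower L M R k i‖ ≤ d * (α ^ 2 + 2 * β) :=
  norm_zTower_le (h.toGlobal_of_top hL htop) k i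

end ZTower

end Summit.QuantumFields.BalabanUV.T4Continuum.RegularBackgroundLocal
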